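import Summits.QuantumFields.YangMills.Theorems.ForcedResponseSkewnessResponseLocalisationSignedToolkit
import Summits.QuantumFields.YangMills.Theorems.ForcedResponseSkewnessResponseLocalisationFarCharged
import HarnessLib

/-!
# Route `ForcedResponseSkewness`, crux `ResponseLocalisation` (stmt-QuantumFields-24869), line «signed-femto-collar»: geometry of the
# signed cut-off (for the registered analysis stub `stub_signedOfSymKernel : SignedOfSymKernelSigR`, Defs p613181)

Helper file (`--supports stmt-QuantumFields-24869`, seat `ym-line-frs-p2` g6):

* `exists_signed_cutoff` — for a base point `p` (`p₀ > 0`), a radius `0 < R ≤ p₀/4` and a source radius `ρ ≤ R/4`: a Lipschitz radial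
  profile `F` (`= 1` on `[0,R/2]`, `= 0` on `[R,∞)`) and the cut-off `χ = F(‖· − p‖) + F(‖· − θp‖)` — smooth, compactly supported,
  `[0,1]`-valued (the two bumps are `2p₀ ≥ 8R` apart), `= 0` off the ball of radius `‖p‖ + R`, and `= 1` within `R/4` of any point
  `k` with `‖k − p‖ ≤ ρ` or `‖k − θp‖ ≤ ρ` (so `χ = 1` on the `R/4`-thickening of `tsupport v ∪ tsupport θv` for `v ⊆ closedBall p ρ`).
* `abs_torusK3_le_shell` — the FBL-collar bound `(2C₁/M⁴)³` for `κ₃(x,u,f)` and `κ₃(x,f,u)` when `x` lies on the physical shell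
  `R/4 ≤ s‖x − u‖ ≤ 5R/4` around the near insertion `u` and the far insertion `f` is time-separated from `u`
  (`4R ≤ s|u₀ − f₀| ≤ 2R'`), with `2(2M+4)s ≤ R/4` and `5R/4 + 2R' ≤ sL` (coordinate separations `≥ 2M+4`, no wrap-around).

Honest label: geometry/bookkeeping on a conditional rung line (leaf R2a `BalabanLadder.NT`); NT and the YM mass gap are NOT proved by this.
-/

set_option autoImplicit false

noncomputable section

namespace Summit.QuantumFields.YangMills.Cruxes.ResponseLocalisation.Signed

open scoped ContDiff
open Set Metric MeasureTheory
open Literature.MathematicalPhysics.QuantumFieldTheory Literature.MathematicalPhysics.QuantumLattice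
open Literature.Probability.LatticeModels
open Summit.QuantumFields.YangMills.Cruxes.OSLegsFromFemtoAndGap.DlrCollarTransfer
open Summit.QuantumFields.YangMills.Cruxes.ResponseLocalisation.Far

/-! ## §1 The signed cut-off of a base point -/

/-- **The signed radial cut-off** `χ = F(‖· − p‖) + F(‖· − θp‖)` of a base point with `p₀ > 0` (see the module docstring). [folklore] -/
theorem exists_signed_cutoff (p : EuclideanSpace ℝ (Fin 4)) (hp0 : 0 < p 0) {R ρ : ℝ} (hR : 0 < R) (hRp : R ≤ p 0 / 4)
    (hρR : ρ ≤ R / 4) :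
    ∃ F : ℝ → ℝ, ∃ LF : ℝ, ∃ χf : EuclideanSpace ℝ (Fin 4) → ℝ,
      0 ≤ LF ∧ (∀ t, 0 ≤ F t) ∧ (∀ t, F t ≤ 1) ∧ (∀ t, t ≤ R / 2 → F t = 1) ∧ (∀ t, R ≤ t → F t = 0) ∧
      (∀ t t', |F t - F t'| ≤ LF * |t - t'|) ∧ ContDiff ℝ ∞ χf ∧ HasCompactSupport χf ∧
      (∀ u, χf u = F ‖u - p‖ + F ‖u - (timeReflection 4) p‖) ∧ (∀ u, χf u ∈ Set.Icc (0 : ℝ) 1) ∧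
      (∀ u, ‖p‖ + R < ‖u‖ → χf u = 0) ∧
      (∀ u k : EuclideanSpace ℝ (Fin 4), (‖k - p‖ ≤ ρ ∨ ‖k - (timeReflection 4) p‖ ≤ ρ) → ‖u - k‖ < R / 4 → χf u = 1) := by
  obtain ⟨F, LF, hLF0, hF0, hF1, hFone, hFzero, hFlip, hFsmooth⟩ :=
    exists_radial_profile (r₁ := R / 2) (R₀ := R) (by positivity) (by linarith)
  set θp : EuclideanSpace ℝ (Fin 4) := (timeReflection 4) p with hθpdef
  have hθp_norm : ‖θp‖ = ‖p‖ := (timeReflection 4).norm_map p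
  have hpθp : 2 * p 0 ≤ ‖p - θp‖ := by
    have h := PiLp.norm_apply_le (p - θp) (0 : Fin 4)
    rw [Real.norm_eq_abs] at h
    have e : (p - θp) 0 = 2 * p 0 := by
      rw [PiLp.sub_apply, hθpdef, timeReflection_apply]; simp; ring
    rw [e, abs_of_pos (by positivity)] at h
    exact h
  set χf : EuclideanSpace ℝ (Fin 4) → ℝ := fun u => F ‖u - p‖ + F ‖u - θp‖ with hχfdef
  have hχzero : ∀ u : EuclideanSpace ℝ (Fin 4), ‖p‖ + R < ‖u‖ → χf u = 0 := by
    intro u hu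
    have h1 : R ≤ ‖u - p‖ := by have := norm_sub_norm_le u p; linarith
    have h2 : R ≤ ‖u - θp‖ := by have := norm_sub_norm_le u θp; rw [hθp_norm] at this; linarith
    simp only [hχfdef, hFzero _ h1, hFzero _ h2, add_zero]
  -- at most one of the two bumps is non-zero at any point
  have hone : ∀ u : EuclideanSpace ℝ (Fin 4), F ‖u - p‖ = 0 ∨ F ‖u - θp‖ = 0 := by
    intro u
    by_cases h1 : R ≤ ‖u - p‖
    · exact Or.inl (hFzero _ h1)
    · right
      apply hFzero
      rw [not_le] at h1
      have h2 := norm_sub_le_norm_sub_add_norm_sub p u θp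
      rw [norm_sub_rev p u] at h2
      linarith
  refine ⟨F, LF, χf, hLF0, hF0, hF1, hFone, hFzero, hFlip, (hFsmooth p).add (hFsmooth θp), ?_, fun u => rfl, ?_, hχzero, ?_⟩
  · refine HasCompactSupport.intro (isCompact_closedBall (0 : EuclideanSpace ℝ (Fin 4)) (‖p‖ + R)) fun u hu => ?_
    rw [Metric.mem_closedBall, dist_zero_right, not_le] at hu
    exact hχzero u hu
  · intro u
    simp only [hχfdef, Set.mem_Icc]
    refine ⟨add_nonneg (hF0 _) (hF0 _), ?_⟩
    rcases hone u with h | h <;> rw [h] <;> simp [hF1]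
  · intro u k hk huk
    simp only [hχfdef]
    rcases hk with hkp | hkθ
    · have hup : ‖u - p‖ ≤ R / 2 := by
        have := norm_add_le (u - k) (k - p); rw [sub_add_sub_cancel] at this; linarith
      have huθ : R ≤ ‖u - θp‖ := by
        have h1 := norm_sub_norm_le (p - θp) (p - u)
        rw [sub_sub_sub_cancel_left, norm_sub_rev p u] at h1
        linarith
      rw [hFone _ hup, hFzero _ huθ, add_zero]
    · have hup : ‖u - θp‖ ≤ R / 2 := by
        have := norm_add_le (u - k) (k - θp); rw [sub_add_sub_cancel] at this; linarith
      have hup' : R ≤ ‖u - p‖ := by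
        have h1 := norm_sub_norm_le (p - θp) (u - θp)
        rw [sub_sub_sub_cancel_right] at h1
        have e : ‖p - u‖ = ‖u - p‖ := norm_sub_rev p u
        linarith
      rw [hFzero _ hup', hFone _ hup, zero_add]



/-! ## §1c Two small lattice facts -/

/-- A lattice point `z` with `‖s·z‖ ≤ R'` plus a vector `w` with `a‖w‖ < RK` stays in `box L` when `a ≤ s` and `R' + RK ≤ a·L`. [folklore] -/
theorem add_mem_box {s a R' RK : ℝ} (hs : 0 < s) (ha : 0 < a) (hsa : a ≤ s) {L : ℕ} (hL : R' + RK ≤ a * L)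
    (z : Fin 4 → ℤ) (hz : ‖s • siteToE z‖ ≤ R') (w : Fin 4 → ℤ) (hw : a * ‖siteToE w‖ < RK) : z + w ∈ box 4 L := by
  have hcoord : ∀ (w : Fin 4 → ℤ) (k : Fin 4), |((w k : ℤ) : ℝ)| ≤ ‖siteToE w‖ := by
    intro w k
    have h := PiLp.norm_apply_le (siteToE w) k
    rwa [siteToE_apply, Real.norm_eq_abs] at h
  rw [mem_box]
  intro k
  have h1 : s * |((z k : ℤ) : ℝ)| ≤ R' := by
    have := mul_le_mul_of_nonneg_left (hcoord z k) hs.le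
    rw [norm_smul, Real.norm_of_nonneg hs.le] at hz; linarith
  have h2 : a * |((w k : ℤ) : ℝ)| < RK := lt_of_le_of_lt (mul_le_mul_of_nonneg_left (hcoord w k) ha.le) hw
  have h3 : a * |((z k : ℤ) : ℝ)| ≤ R' := (mul_le_mul_of_nonneg_right hsa (abs_nonneg _)).trans h1
  have h4 : a * (|((z k : ℤ) : ℝ)| + |((w k : ℤ) : ℝ)|) ≤ a * L := by rw [mul_add]; linarith only [h2, h3, hL]
  have h5 : |((z k : ℤ) : ℝ)| + |((w k : ℤ) : ℝ)| ≤ L := le_of_mul_le_mul_left h4 ha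
  have h6 : |(((z + w) k : ℤ) : ℝ)| ≤ L := by
    rw [Pi.add_apply, Int.cast_add]; exact (abs_add_le _ _).trans h5
  have h7 : |(z + w) k| ≤ (L : ℤ) := by exact_mod_cast h6
  exact ⟨by linarith [(abs_le.1 h7).1], (abs_le.1 h7).2⟩

/-- The shell count: at most `(5R/a)⁴` lattice points of any finite set within `5R/(4s)` of `w` when `0 < a ≤ s`, `a ≤ R/2`. [folklore] -/
theorem card_shell_le (S : Finset (Fin 4 → ℤ)) (w : Fin 4 → ℤ) {s a R : ℝ} (ha : 0 < a) (hsa : a ≤ s) (hR : 0 < R)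
    (haR : a ≤ R / 2) :
    (((S.filter fun x => ‖siteToE (x - w)‖ ≤ 5 * R / (4 * s)).card : ℕ) : ℝ) ≤ (5 * R / a) ^ 4 := by
  have hs : 0 < s := lt_of_lt_of_le ha hsa
  refine (card_filter_norm_sub_le S w (by positivity)).trans ?_
  have h1 : 2 * (5 * R / (4 * s)) + 1 ≤ 5 * R / a := by
    have h2 : 5 * R / (4 * s) ≤ 5 * R / (4 * a) :=
      div_le_div_of_nonneg_left (by positivity) (by positivity) (by linarith)
    have h3 : (1 : ℝ) ≤ 5 * R / (2 * a) := by rw [le_div_iff₀ (by positivity)]; linarith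
    have e : 5 * R / a = 2 * (5 * R / (4 * a)) + 5 * R / (2 * a) := by field_simp; ring
    rw [e]; linarith
  exact pow_le_pow_left₀ (by positivity) h1 4

/-! ## §1b The offset of the cut-off against a radial weight about a near insertion -/

/-- **Offset bound.**  For a centre `c`, a near lattice insertion `u` with `‖s·u − c‖ ≤ ρ ≤ R/4`, the cut-off profile `F` (`= 1` on
`[0,R/2]`, `= 0` on `[R,∞)`, `Lip(F) = LF`) and any per-site bound `A` for `K3` on the shell `R/4 ≤ s‖x − u‖ ≤ 5R/4`:
`Σ_x |(F‖s x − c‖ − F(s‖x − u‖)) K3 x| ≤ #{x : ‖x − u‖ ≤ 5R/(4s)} · LF ρ A`. [folklore] -/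
theorem sum_abs_offset_le {F : ℝ → ℝ} {LF ρ s R A : ℝ} (S : Finset (Fin 4 → ℤ)) (K3 : (Fin 4 → ℤ) → ℝ)
    (c : EuclideanSpace ℝ (Fin 4)) (u : Fin 4 → ℤ)
    (hLF0 : 0 ≤ LF) (hFone : ∀ t, t ≤ R / 2 → F t = 1) (hFzero : ∀ t, R ≤ t → F t = 0)
    (hFlip : ∀ t t', |F t - F t'| ≤ LF * |t - t'|) (hs : 0 < s) (hρ0 : 0 ≤ ρ) (hρR : ρ ≤ R / 4) (hA : 0 ≤ A)
    (hcu : ‖s • siteToE u - c‖ ≤ ρ)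
    (hshell : ∀ x ∈ S, R / 4 ≤ s * ‖siteToE (x - u)‖ → s * ‖siteToE (x - u)‖ ≤ 5 * R / 4 → |K3 x| ≤ A) :
    ∑ x ∈ S, |(F ‖s • siteToE x - c‖ - F (s * ‖siteToE (x - u)‖)) * K3 x| ≤
      (((S.filter fun x => ‖siteToE (x - u)‖ ≤ 5 * R / (4 * s)).card : ℕ) : ℝ) * (LF * ρ * A) := by
  have hsmul : ∀ x : Fin 4 → ℤ, ‖s • siteToE x - s • siteToE u‖ = s * ‖siteToE (x - u)‖ := by
    intro x
    rw [← smul_sub, norm_smul, Real.norm_of_nonneg hs.le]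
    congr 1
    rw [show siteToE (x - u) = siteToE x - siteToE u from by ext i; simp [siteToE_apply]]
  have hdiff : ∀ x : Fin 4 → ℤ, |‖s • siteToE x - c‖ - s * ‖siteToE (x - u)‖| ≤ ρ := by
    intro x
    rw [← hsmul x]
    have := abs_norm_sub_norm_le (s • siteToE x - c) (s • siteToE x - s • siteToE u)
    rw [sub_sub_sub_cancel_left] at this
    exact this.trans hcu
  -- support of the offset: the shell
  have hoff : ∀ x : Fin 4 → ℤ, F ‖s • siteToE x - c‖ - F (s * ‖siteToE (x - u)‖) ≠ 0 →
      R / 4 ≤ s * ‖siteToE (x - u)‖ ∧ s * ‖siteToE (x - u)‖ ≤ 5 * R / 4 := by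
    intro x hne
    by_contra hcon
    rw [not_and_or, not_le, not_le] at hcon
    rcases hcon with hlt | hgt
    · have h1 : s * ‖siteToE (x - u)‖ ≤ R / 2 := by linarith
      have h2 : ‖s • siteToE x - c‖ ≤ R / 2 := by have := (abs_le.1 (hdiff x)).2; linarith
      exact hne (by rw [hFone _ h2, hFone _ h1, sub_self])
    · have h1 : R ≤ s * ‖siteToE (x - u)‖ := by linarith
      have h2 : R ≤ ‖s • siteToE x - c‖ := by have := (abs_le.1 (hdiff x)).1; linarith
      exact hne (by rw [hFzero _ h2, hFzero _ h1, sub_self])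
  -- sup of the offset
  have hlip : ∀ x : Fin 4 → ℤ, |F ‖s • siteToE x - c‖ - F (s * ‖siteToE (x - u)‖)| ≤ LF * ρ := fun x =>
    (hFlip _ _).trans (mul_le_mul_of_nonneg_left (hdiff x) hLF0)
  have hpt : ∀ x ∈ S, |(F ‖s • siteToE x - c‖ - F (s * ‖siteToE (x - u)‖)) * K3 x| ≤
      (if ‖siteToE (x - u)‖ ≤ 5 * R / (4 * s) then LF * ρ * A else 0) := by
    intro x hx
    by_cases hne : F ‖s • siteToE x - c‖ - F (s * ‖siteToE (x - u)‖) = 0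
    · rw [hne, zero_mul, abs_zero]; split_ifs; · positivity
      · exact le_rfl
    obtain ⟨hlo, hhi⟩ := hoff x hne
    have hin : ‖siteToE (x - u)‖ ≤ 5 * R / (4 * s) := by
      rw [le_div_iff₀ (by positivity)]; linarith
    rw [if_pos hin, abs_mul]
    exact mul_le_mul (hlip x) (hshell x hx hlo hhi) (abs_nonneg _) (by positivity)
  refine (Finset.sum_le_sum hpt).trans (le_of_eq ?_)
  rw [Finset.sum_ite, Finset.sum_const_zero, add_zero, Finset.sum_const, nsmul_eq_mul]

/-! ## §2 The FBL-collar bound on the offset shell -/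

section Torus

variable (G : Type) [Group G] [TopologicalSpace G] [IsTopologicalGroup G] [CompactSpace G]
  [MeasurableSpace G] [BorelSpace G] (r : LatticeRep G)

/-- **Per-site third-cumulant bound on the offset shell** (see the module docstring): coordinate separations `≥ 2M+4` of the
triple from the shell condition (a large coordinate of `x − u`) and the time separation of the charged pair; then
`abs_torusK3_le_of_fbl` for both orders of the last two arguments. [folklore] -/
theorem abs_torusK3_le_shell (β : ℝ) {aβ C₁ ℓ₁ p : ℝ} (hC₁ : 0 ≤ C₁)
    (hF : ∀ (c : Fin 4 → ℤ) (b : ℕ), (b : ℝ) * aβ ≤ ℓ₁ → ∀ (η : LGConfig 4 G) (w : Fin 4 → ℤ),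
      2 ≤ depth c b w → |kerE G r β c b η (dens G r w) - p| ≤ C₁ / (depth c b w : ℝ) ^ 4)
    {L M : ℕ} (hM : 1 ≤ M) (hb : ((2 * M + 3 : ℕ) : ℝ) * aβ ≤ ℓ₁) (hML : 4 * M + 8 ≤ L)
    {s R R' : ℝ} (hs : 0 < s) (hR : 0 < R) (hMsep : 2 * (2 * (M : ℝ) + 4) * s ≤ R / 4) (hbox : 5 * R / 4 + 2 * R' ≤ s * L)
    (x u f : Fin 4 → ℤ) (htime : 4 * R ≤ s * |((u 0 : ℤ) : ℝ) - f 0|) (htime' : s * |((u 0 : ℤ) : ℝ) - f 0| ≤ 2 * R')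
    (hlo : R / 4 ≤ s * ‖siteToE (x - u)‖) (hhi : s * ‖siteToE (x - u)‖ ≤ 5 * R / 4) :
    |torusK3 G r β L x u f| ≤ (2 * C₁ / (M : ℝ) ^ 4) ^ 3 ∧ |torusK3 G r β L x f u| ≤ (2 * C₁ / (M : ℝ) ^ 4) ^ 3 := by
  have hcoord : ∀ (w : Fin 4 → ℤ) (k : Fin 4), |((w k : ℤ) : ℝ)| ≤ ‖siteToE w‖ := by
    intro w k
    have h := PiLp.norm_apply_le (siteToE w) k
    rwa [siteToE_apply, Real.norm_eq_abs] at h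
  have hMsep1 : (2 * (M : ℝ) + 4) * s ≤ R / 8 := by
    have : 0 ≤ (2 * (M : ℝ) + 4) * s := by positivity
    linarith only [hMsep, this]
  -- integer form of a real lower/upper bound on a coordinate difference
  have cast_lo : ∀ m : ℤ, (2 * (M : ℝ) + 4) ≤ |((m : ℤ) : ℝ)| → (2 * (M : ℤ) + 4) ≤ |m| := by
    intro m hm
    have h : ((2 * (M : ℤ) + 4 : ℤ) : ℝ) ≤ ((|m| : ℤ) : ℝ) := by push_cast; exact hm
    exact_mod_cast h
  have cast_hi : ∀ m : ℤ, s * |((m : ℤ) : ℝ)| ≤ s * L → |m| ≤ (L : ℤ) := by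
    intro m hm
    have h : |((m : ℤ) : ℝ)| ≤ L := le_of_mul_le_mul_left hm hs
    exact_mod_cast h
  -- (x,u): a large coordinate of `x − u`
  have hxu : ∃ k : Fin 4, (2 * (M : ℤ) + 4) ≤ |((((x k - u k : ℤ) : ZMod (2 * L + 1))).valMinAbs : ℤ)| := by
    obtain ⟨k, -, hk⟩ := exists_sup_coord_norm_le (x - u)
    refine sep_of_coord L M x u k ?_ ?_
    · have h1 : 2 * (2 * (M : ℝ) + 4) * s ≤ s * ‖siteToE (x - u)‖ := hMsep.trans hlo
      have h2 : 2 * (2 * (M : ℝ) + 4) ≤ ‖siteToE (x - u)‖ := by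
        rw [mul_comm] at h1; exact le_of_mul_le_mul_left h1 hs
      have h3 := cast_lo ((x - u) k) (by linarith only [h2, hk])
      simpa [Pi.sub_apply] using h3
    · have h1 : s * |(((x - u) k : ℤ) : ℝ)| ≤ 5 * R / 4 := (mul_le_mul_of_nonneg_left (hcoord (x - u) k) hs.le).trans hhi
      have h2 := cast_hi ((x - u) k) (by
        have : 0 ≤ 2 * R' := by
          have := (mul_nonneg hs.le (abs_nonneg (((u 0 : ℤ) : ℝ) - f 0))); linarith only [this, htime']
        linarith only [h1, hbox, this, hR])
      simpa [Pi.sub_apply] using h2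
  -- (u,f) and (f,u): the time coordinate
  have huf0 : (2 * (M : ℤ) + 4) ≤ |u 0 - f 0| ∧ |u 0 - f 0| ≤ (L : ℤ) := by
    constructor
    · refine cast_lo (u 0 - f 0) ?_
      push_cast
      have h1 : (2 * (M : ℝ) + 4) * s ≤ s * |((u 0 : ℤ) : ℝ) - f 0| := by linarith only [hMsep1, htime, hR]
      rw [mul_comm] at h1; exact le_of_mul_le_mul_left h1 hs
    · refine cast_hi (u 0 - f 0) ?_
      push_cast; linarith only [htime', hbox, hR]
  have huf : ∃ k : Fin 4, (2 * (M : ℤ) + 4) ≤ |((((u k - f k : ℤ) : ZMod (2 * L + 1))).valMinAbs : ℤ)| :=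
    sep_of_coord L M u f 0 huf0.1 huf0.2
  have hfu : ∃ k : Fin 4, (2 * (M : ℤ) + 4) ≤ |((((f k - u k : ℤ) : ZMod (2 * L + 1))).valMinAbs : ℤ)| :=
    sep_of_coord L M f u 0 (by rw [abs_sub_comm]; exact huf0.1) (by rw [abs_sub_comm]; exact huf0.2)
  -- (x,f): `|x₀ − f₀| ≥ |u₀ − f₀| − |x₀ − u₀| ≥ 4R/s − 5R/(4s)`
  have hxu0 : s * |((x 0 : ℤ) : ℝ) - u 0| ≤ 5 * R / 4 := by
    have := hcoord (x - u) 0; rw [Pi.sub_apply, Int.cast_sub] at this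
    exact (mul_le_mul_of_nonneg_left this hs.le).trans hhi
  have hxf0 : (2 * (M : ℤ) + 4) ≤ |x 0 - f 0| ∧ |x 0 - f 0| ≤ (L : ℤ) := by
    have htri1 : |((u 0 : ℤ) : ℝ) - f 0| ≤ |((x 0 : ℤ) : ℝ) - u 0| + |((x 0 : ℤ) : ℝ) - f 0| := by
      have := abs_sub_le (((u 0 : ℤ) : ℝ)) (x 0) (f 0); rwa [abs_sub_comm ((u 0 : ℤ) : ℝ) (x 0)] at this
    have htri2 : |((x 0 : ℤ) : ℝ) - f 0| ≤ |((x 0 : ℤ) : ℝ) - u 0| + |((u 0 : ℤ) : ℝ) - f 0| := abs_sub_le _ _ _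
    have hm1 := mul_le_mul_of_nonneg_left htri1 hs.le
    have hm2 := mul_le_mul_of_nonneg_left htri2 hs.le
    rw [mul_add] at hm1 hm2
    constructor
    · refine cast_lo (x 0 - f 0) ?_
      push_cast
      have h1 : (2 * (M : ℝ) + 4) * s ≤ s * |((x 0 : ℤ) : ℝ) - f 0| := by linarith only [hMsep1, htime, hm1, hxu0, hR]
      rw [mul_comm] at h1; exact le_of_mul_le_mul_left h1 hs
    · refine cast_hi (x 0 - f 0) ?_
      push_cast; linarith only [hm2, hxu0, htime', hbox]
  have hxf : ∃ k : Fin 4, (2 * (M : ℤ) + 4) ≤ |((((x k - f k : ℤ) : ZMod (2 * L + 1))).valMinAbs : ℤ)| :=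
    sep_of_coord L M x f 0 hxf0.1 hxf0.2
  exact ⟨abs_torusK3_le_of_fbl G r β hC₁ hF hM hb hML x u f hxu hxf huf,
    abs_torusK3_le_of_fbl G r β hC₁ hF hM hb hML x f u hxf hxu hfu⟩

end Torus

end Summit.QuantumFields.YangMills.Cruxes.ResponseLocalisation.Signed

end
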